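import Mathlib.Data.ZMod.Basic
import Mathlib.Data.Real.Basic
import Mathlib.Algebra.BigOperators.Intervals
import Mathlib.Algebra.BigOperators.Ring.Finset
import Mathlib.Algebra.Order.BigOperators.Ring.Finset
import Mathlib.Tactic.FieldSimp
import Mathlib.Tactic.Linarith
import Mathlib.Tactic.Ring
import Mathlib.Tactic.Abel
import Mathlib.Tactic.Positivity
import HarnessLib

/-!
# Positivity of the second Bernoulli polynomial on `ℤ/nℤ` (the Fourier step of Petsche's Lemma 3)

Pure proofs (theorems only, Mathlib imports only) in topic `NumberTheory/EllipticCurves`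
(family `abc`, G06), for the named fact `Literature.NumberTheory.EllipticCurves.Petsche2006_lemma3`
(file `LangHeightNonarchEstimate.lean`; C. Petsche, *Small rational points on elliptic curves over
number fields*, New York J. Math. 12 (2006), Lemma 3), the last remaining input of the formal proof
of Petsche's Theorem 2 over `ℚ` (`Petsche2006_langHeightLowerBound_of_lemma3`,
`LangHeightKodairaNeronProofs.lean`).

At a place `v` with `|j_E|_v > 1` Petsche bounds the `j_v`-part of the local height–discriminant
sum through the Fourier expansion of the periodic second Bernoulli polynomial (p. 260, display
(17)–(18) of the journal version; arXiv math/0508160, p. 4): *"Since the map `r` is trivial on the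
identity component `E₀(k_v)`, it is well-defined on the quotient `E(k_v)/E₀(k_v)`, which has
cardinality `c_v`. Therefore `r(E(k_v)) ⊆ ⟨1/c_v⟩ ⊂ ℝ/ℤ` … It follows that
`Σ_{i,j} j_v(P_i, P_j) = (log|j_E|_v / 4π²) Σ_{m ∈ ℤ∖{0}} m⁻² |Σ_j e^{2πimr(P_j)}|²
≥ (N² log|j_E|_v / 4π²) Σ_{m ∈ c_vℤ∖{0}} m⁻² = N² log|j_E|_v / (12 c_v²)"*,
i.e. for `N` elements `r_1, …, r_N` of the cyclic group `(1/c)ℤ/ℤ`,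

  `Σ_{i,j} B₂(r_i − r_j) ≥ N²/(6c²)`,  `B₂(t) = t² − t + 1/6` on `[0, 1)`.

This file proves that inequality (`card_sq_div_le_sum_sum_bernoulli`), with `ℤ/cℤ` as Mathlib's
`ZMod c` and the representative `t = (r_i − r_j).val / c ∈ [0, 1)`, by an exact **sum-of-squares
identity** instead of Fourier series: with `m = (c − 1)/2` and the discrete sawtooth
`s(e) = e.val − m` on `ZMod c`,

  `B₂(d.val/c) − 1/(6c²) = (2/c³) Σ_{e ∈ ℤ/c} s(e) s(e + d)`        (`bernoulli_val_eq_sum_sawtooth`)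

(the discrete analogue of `𝐁₂ = 2 · 𝐁₁ ⋆ 𝐁₁⁻`; a finite computation with `Σ e` and `Σ e²` over
`range c`, `sum_sawtooth_mul_sawtooth_add`), whence

  `Σ_{i,j} B₂((r_i − r_j).val/c) = N²/(6c²) + (2/c³) Σ_e (Σ_i s(e + r_i))² ≥ N²/(6c²)`.

Equality holds for the uniform distribution on `ℤ/cℤ`, so the constant is sharp, as in Petsche's
Lemma 3 (the coefficient `1/c_v²`).

## References

* C. Petsche, *Small rational points on elliptic curves over number fields*, New York J. Math. 12
  (2006), 257–268 (arXiv math/0508160): proof of Lemma 3, displays (17)–(18).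
* M. Hindry, J. H. Silverman, *On Lehmer's conjecture for elliptic curves*, Sém. Théorie des
  Nombres Paris 1988–89, Progr. Math. 91 (1990), 103–116, Prop. 1.2 (the same Fourier argument).

## Design

Mathlib-only imports (`ZMod`, real finite sums); no definitions; namespace = path. The Bernoulli
polynomial is written out as `t ^ 2 - t + 1 / 6` so that the file does not depend on the modular
forms imports of `LangHeightArchEstimate.lean` (whose `bernoulliTwo` unfolds to it by
`bernoulliTwo_def`).
-/

noncomputable section

open Finset

namespace Literature.NumberTheory.EllipticCurves

/-! ### Two power sums over `range n`, over `ℝ` -/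

/-- `Σ_{i<n} i = n(n−1)/2` in `ℝ`. [folklore] -/
theorem sum_range_natCast_real (n : ℕ) : ∑ i ∈ range n, (i : ℝ) = n * (n - 1) / 2 := by
  induction n with
  | zero => simp
  | succ k ih =>
    rw [sum_range_succ, ih]
    push_cast
    ring

/-- `Σ_{i<n} i² = n(n−1)(2n−1)/6` in `ℝ`. [folklore] -/
theorem sum_range_natCast_sq_real (n : ℕ) :
    ∑ i ∈ range n, (i : ℝ) ^ 2 = n * (n - 1) * (2 * n - 1) / 6 := by
  induction n with
  | zero => simp
  | succ k ih =>
    rw [sum_range_succ, ih]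
    push_cast
    ring

/-! ### Sums over `ZMod n` as sums over `range n` -/

/-- For `n ≥ 1`, a sum over `ZMod n` of a function of the representative `e.val ∈ {0, …, n − 1}` is
the corresponding sum over `range n`. [folklore] -/
theorem sum_zmod_val_eq_sum_range {n : ℕ} [NeZero n] {M : Type*} [AddCommMonoid M] (f : ℕ → M) :
    ∑ e : ZMod n, f e.val = ∑ i ∈ range n, f i := by
  obtain ⟨k, rfl⟩ : ∃ k, n = k + 1 := ⟨n - 1, (Nat.succ_pred_eq_of_pos (NeZero.pos n)).symm⟩
  exact Fin.sum_univ_eq_sum_range f (k + 1)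

/-! ### The autocorrelation of the discrete sawtooth -/

/-- **Autocorrelation of the discrete sawtooth.** For `n ≥ 1`, `m = (n − 1)/2` and `d ∈ ℤ/nℤ` with
representative `x = d.val`,
`Σ_{e ∈ ℤ/n} (e.val − m)((e + d).val − m) = (n/2)(x² − n x + (n² − 1)/6)`.
Proof: `(e + d).val = e.val + x` for `e.val < n − x` and `= e.val + x − n` otherwise, so the sum
is `Σ_{i<n} (i − m)(i + x − m) − n Σ_{n−x ≤ i < n} (i − m)`, and both pieces are evaluated with
`Σ i = n(n−1)/2`, `Σ i² = n(n−1)(2n−1)/6`. [folklore] -/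
theorem sum_sawtooth_mul_sawtooth_add {n : ℕ} [NeZero n] (d : ZMod n) :
    ∑ e : ZMod n, ((e.val : ℝ) - ((n : ℝ) - 1) / 2) * (((e + d).val : ℝ) - ((n : ℝ) - 1) / 2) =
      (n : ℝ) / 2 * ((d.val : ℝ) ^ 2 - n * (d.val : ℝ) + ((n : ℝ) ^ 2 - 1) / 6) := by
  have hn : 0 < n := NeZero.pos n
  set x : ℕ := d.val with hx
  have hxn : x < n := ZMod.val_lt d
  set m : ℝ := ((n : ℝ) - 1) / 2 with hm
  -- rewrite `(e + d).val` through `e.val`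
  have hval : ∀ e : ZMod n, (e + d).val = (e.val + x) % n := fun e => ZMod.val_add e d
  have h1 : ∑ e : ZMod n, ((e.val : ℝ) - m) * (((e + d).val : ℝ) - m) =
      ∑ e : ZMod n, ((e.val : ℝ) - m) * ((((e.val + x) % n : ℕ) : ℝ) - m) := by
    refine Finset.sum_congr rfl fun e _ => ?_
    rw [hval e]
  rw [h1, sum_zmod_val_eq_sum_range (fun i : ℕ => ((i : ℝ) - m) * ((((i + x) % n : ℕ) : ℝ) - m))]
  -- split `range n` at `n - x`
  have hsplit := (Finset.sum_Ico_consecutive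
    (fun i : ℕ => ((i : ℝ) - m) * ((((i + x) % n : ℕ) : ℝ) - m)) (Nat.zero_le (n - x))
    (Nat.sub_le n x))
  rw [Finset.range_eq_Ico, ← hsplit]
  -- on the first piece `(i + x) % n = i + x`, on the second `= i + x - n`
  have hlow : ∑ i ∈ Ico 0 (n - x), ((i : ℝ) - m) * ((((i + x) % n : ℕ) : ℝ) - m) =
      ∑ i ∈ Ico 0 (n - x), ((i : ℝ) - m) * ((i : ℝ) + x - m) := by
    refine Finset.sum_congr rfl fun i hi => ?_
    rw [Finset.mem_Ico] at hi
    have hlt : i + x < n := by omega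
    rw [Nat.mod_eq_of_lt hlt]
    push_cast
    ring
  have hhigh : ∑ i ∈ Ico (n - x) n, ((i : ℝ) - m) * ((((i + x) % n : ℕ) : ℝ) - m) =
      ∑ i ∈ Ico (n - x) n, ((i : ℝ) - m) * ((i : ℝ) + x - m) -
        n * ∑ i ∈ Ico (n - x) n, ((i : ℝ) - m) := by
    rw [Finset.mul_sum, ← Finset.sum_sub_distrib]
    refine Finset.sum_congr rfl fun i hi => ?_
    rw [Finset.mem_Ico] at hi
    have hge : n ≤ i + x := by omega
    have hlt : i + x - n < n := by omega
    have hmod : (i + x) % n = i + x - n := by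
      rw [Nat.mod_eq_sub_mod hge, Nat.mod_eq_of_lt hlt]
    rw [hmod, Nat.cast_sub hge]
    push_cast
    ring
  rw [hlow, hhigh, ← add_sub_assoc, Finset.sum_Ico_consecutive _ (Nat.zero_le (n - x))
    (Nat.sub_le n x), ← Finset.range_eq_Ico]
  -- evaluate the two remaining sums
  have hfull : ∑ i ∈ range n, ((i : ℝ) - m) * ((i : ℝ) + x - m) =
      ∑ i ∈ range n, (i : ℝ) ^ 2 + ((x : ℝ) - 2 * m) * ∑ i ∈ range n, (i : ℝ) +
        n * (m * (m - x)) := by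
    rw [Finset.mul_sum, ← Finset.sum_add_distrib]
    have : ∑ i ∈ range n, ((i : ℝ) - m) * ((i : ℝ) + x - m) =
        ∑ i ∈ range n, ((i : ℝ) ^ 2 + ((x : ℝ) - 2 * m) * (i : ℝ) + m * (m - x)) :=
      Finset.sum_congr rfl fun i _ => by ring
    rw [this, Finset.sum_add_distrib, Finset.sum_const, Finset.card_range, nsmul_eq_mul]
  have htail : ∑ i ∈ Ico (n - x) n, ((i : ℝ) - m) =
      (n * (n - 1) / 2 - (n - x : ℝ) * ((n - x : ℝ) - 1) / 2) - x * m := by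
    rw [Finset.sum_sub_distrib, Finset.sum_const, Nat.card_Ico, nsmul_eq_mul,
      Finset.sum_Ico_eq_sub _ (Nat.sub_le n x), sum_range_natCast_real, sum_range_natCast_real,
      Nat.cast_sub (Nat.sub_le n x), Nat.cast_sub hxn.le]
    ring
  rw [hfull, htail, sum_range_natCast_real, sum_range_natCast_sq_real, hm]
  ring

/-- Two-variable form: `Σ_{e ∈ ℤ/n} s(e + a) s(e + b) = (n/2)(x² − n x + (n² − 1)/6)` with
`x = (a − b).val`, `s(e) = e.val − (n−1)/2` (translate `e ↦ e − b`). [folklore] -/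
theorem sum_sawtooth_add_mul_sawtooth_add {n : ℕ} [NeZero n] (a b : ZMod n) :
    ∑ e : ZMod n, (((e + a).val : ℝ) - ((n : ℝ) - 1) / 2) * (((e + b).val : ℝ) - ((n : ℝ) - 1) / 2) =
      (n : ℝ) / 2 * ((((a - b).val : ℕ) : ℝ) ^ 2 - n * (((a - b).val : ℕ) : ℝ) +
        ((n : ℝ) ^ 2 - 1) / 6) := by
  rw [← sum_sawtooth_mul_sawtooth_add (a - b)]
  rw [← Equiv.sum_comp (Equiv.addRight b) (fun e : ZMod n =>
    ((e.val : ℝ) - ((n : ℝ) - 1) / 2) * (((e + (a - b)).val : ℝ) - ((n : ℝ) - 1) / 2))]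
  refine Finset.sum_congr rfl fun e _ => ?_
  simp only [Equiv.coe_addRight]
  have e1 : e + b + (a - b) = e + a := by abel
  rw [e1, mul_comm]

/-! ### The sum-of-squares identity and the positivity bound -/

/-- **`B₂` on `ℤ/nℤ` as a sum of squares, termwise**: for `d ∈ ℤ/nℤ` with representative
`x = d.val ∈ {0, …, n−1}`,
`B₂(x/n) = x²/n² − x/n + 1/6 = 1/(6n²) + (2/n³) Σ_{e ∈ ℤ/n} s(e) s(e + d)`. [folklore] -/
theorem bernoulli_val_eq_sum_sawtooth {n : ℕ} [NeZero n] (a b : ZMod n) :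
    (((a - b).val : ℝ) / n) ^ 2 - ((a - b).val : ℝ) / n + 1 / 6 =
      1 / (6 * (n : ℝ) ^ 2) + 2 / (n : ℝ) ^ 3 *
        ∑ e : ZMod n, (((e + a).val : ℝ) - ((n : ℝ) - 1) / 2) *
          (((e + b).val : ℝ) - ((n : ℝ) - 1) / 2) := by
  have hn : (n : ℝ) ≠ 0 := by exact_mod_cast (NeZero.ne n)
  rw [sum_sawtooth_add_mul_sawtooth_add]
  field_simp
  ring

/-- **Positivity of `B₂` on the cyclic group `(1/n)ℤ/ℤ`** (the Fourier step of Petsche 2006,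
proof of Lemma 3, displays (17)–(18); Hindry–Silverman, *On Lehmer's conjecture for elliptic
curves*, proof of Prop. 1.2): for `n ≥ 1` and any finite family `(r_i)_{i ∈ Z}` of elements of
`ℤ/nℤ`,
`Σ_{i ∈ Z} Σ_{j ∈ Z} B₂((r_i − r_j).val / n) ≥ |Z|² / (6 n²)`,
where `B₂(t) = t² − t + 1/6` and `(r_i − r_j).val / n ∈ [0, 1)` is the representative of
`r_i − r_j` in `(1/n)ℤ/ℤ ⊂ ℝ/ℤ`. Printed proof: the Fourier coefficients of the periodic `B₂` are
`1/(2π²m²) > 0` and the characters `e^{2πimr}` with `n ∣ m` are trivial on `(1/n)ℤ/ℤ`; here, by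
the exact identity `Σ_{i,j} B₂ = |Z|²/(6n²) + (2/n³) Σ_{e ∈ ℤ/n} (Σ_i s(e + r_i))²`
(`bernoulli_val_eq_sum_sawtooth`) with the discrete sawtooth `s(e) = e.val − (n−1)/2`.
[cite: Petsche2006, proof of Lemma 3] -/
theorem card_sq_div_le_sum_sum_bernoulli {n : ℕ} (hn : 0 < n) {ι : Type*} (Z : Finset ι)
    (r : ι → ZMod n) :
    (Z.card : ℝ) ^ 2 / (6 * (n : ℝ) ^ 2) ≤
      ∑ i ∈ Z, ∑ j ∈ Z,
        ((((r i - r j).val : ℝ) / n) ^ 2 - ((r i - r j).val : ℝ) / n + 1 / 6) := by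
  haveI : NeZero n := ⟨hn.ne'⟩
  set s : ZMod n → ℝ := fun e => (e.val : ℝ) - ((n : ℝ) - 1) / 2 with hs
  have key : ∀ i j, (((r i - r j).val : ℝ) / n) ^ 2 - ((r i - r j).val : ℝ) / n + 1 / 6 =
      1 / (6 * (n : ℝ) ^ 2) + 2 / (n : ℝ) ^ 3 * ∑ e : ZMod n, s (e + r i) * s (e + r j) :=
    fun i j => bernoulli_val_eq_sum_sawtooth (r i) (r j)
  simp_rw [key]
  rw [show ∑ i ∈ Z, ∑ j ∈ Z, (1 / (6 * (n : ℝ) ^ 2) +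
      2 / (n : ℝ) ^ 3 * ∑ e : ZMod n, s (e + r i) * s (e + r j)) =
      (Z.card : ℝ) ^ 2 / (6 * (n : ℝ) ^ 2) +
        2 / (n : ℝ) ^ 3 * ∑ e : ZMod n, (∑ i ∈ Z, s (e + r i)) ^ 2 from ?_]
  · have h0 : 0 ≤ 2 / (n : ℝ) ^ 3 * ∑ e : ZMod n, (∑ i ∈ Z, s (e + r i)) ^ 2 :=
      mul_nonneg (by positivity) (Finset.sum_nonneg fun e _ => sq_nonneg _)
    linarith
  -- the rearrangement `Σ_i Σ_j Σ_e f_i(e) f_j(e) = Σ_e (Σ_i f_i(e))²`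
  simp_rw [Finset.sum_add_distrib, Finset.sum_const, nsmul_eq_mul, ← Finset.mul_sum]
  have hswap : ∑ i ∈ Z, ∑ j ∈ Z, ∑ e : ZMod n, s (e + r i) * s (e + r j) =
      ∑ e : ZMod n, (∑ i ∈ Z, s (e + r i)) ^ 2 := by
    calc ∑ i ∈ Z, ∑ j ∈ Z, ∑ e : ZMod n, s (e + r i) * s (e + r j)
        = ∑ i ∈ Z, ∑ e : ZMod n, ∑ j ∈ Z, s (e + r i) * s (e + r j) :=
          Finset.sum_congr rfl fun i _ => Finset.sum_comm
      _ = ∑ e : ZMod n, ∑ i ∈ Z, ∑ j ∈ Z, s (e + r i) * s (e + r j) := Finset.sum_comm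
      _ = ∑ e : ZMod n, (∑ i ∈ Z, s (e + r i)) ^ 2 :=
          Finset.sum_congr rfl fun e _ => by rw [sq, Finset.sum_mul_sum]
  rw [hswap]
  ring

/-- The same bound with the diagonal removed, in the form used for the local height–discriminant
sum `Λ_v(Z) = N⁻² Σ_{i ≠ j} λ_v(P_i − P_j)` (Petsche 2006, proof of Lemma 3, display (18):
`Σ_{i ≠ j} j_v(P_i, P_j) ≥ N² log|j_E|_v/(12 c_v²) − (N/12) log|j_E|_v`): since `B₂(0) = 1/6`,
`Σ_{i ∈ Z} Σ_{j ∈ Z, j ≠ i} B₂((r_i − r_j).val/n) ≥ |Z|²/(6n²) − |Z|/6`.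
[cite: Petsche2006, proof of Lemma 3] -/
theorem card_sq_div_sub_le_sum_sum_erase_bernoulli {n : ℕ} (hn : 0 < n) {ι : Type*}
    [DecidableEq ι] (Z : Finset ι) (r : ι → ZMod n) :
    (Z.card : ℝ) ^ 2 / (6 * (n : ℝ) ^ 2) - (Z.card : ℝ) / 6 ≤
      ∑ i ∈ Z, ∑ j ∈ Z.erase i,
        ((((r i - r j).val : ℝ) / n) ^ 2 - ((r i - r j).val : ℝ) / n + 1 / 6) := by
  have h := card_sq_div_le_sum_sum_bernoulli hn Z r
  have hdiag : ∀ i ∈ Z, ∑ j ∈ Z, ((((r i - r j).val : ℝ) / n) ^ 2 - ((r i - r j).val : ℝ) / n + 1 / 6) =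
      ∑ j ∈ Z.erase i, ((((r i - r j).val : ℝ) / n) ^ 2 - ((r i - r j).val : ℝ) / n + 1 / 6) +
        1 / 6 := by
    intro i hi
    rw [← Finset.add_sum_erase Z _ hi, sub_self, ZMod.val_zero, Nat.cast_zero, zero_div]
    ring
  rw [Finset.sum_congr rfl hdiag, Finset.sum_add_distrib, Finset.sum_const, nsmul_eq_mul] at h
  linarith

end Literature.NumberTheory.EllipticCurves

end
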